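import Mathlib.Data.Nat.Log
import Mathlib.Data.ZMod.Basic
import Literature.Computability.Complexity.FiniteAlphabetGadgets
import HarnessLib

/-!
# Iterated addition in logarithmic depth over `B₂`: carry-save trees (Vollmer 1999, Thm. 1.20)

Bounded fan-in circuits (the `NCVec` calculus of `NCRealize.lean`, basis `B2`) adding `M`
numbers of `W` bits in depth `O(log M)`, by the **carry-save** technique of Vollmer's proof of
`ITADD ∈ FSIZE-DEPTH(n^{O(1)}, log n)` (Vollmer 1999, §1.3.1, Thm. 1.20): three numbers `a, b, c`
are replaced in constant depth by two numbers `d, e` with `a + b + c = d + e`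
(`dᵢ = aᵢ ⊕ bᵢ ⊕ cᵢ`, `e_{i+1} = maj(aᵢ, bᵢ, cᵢ)`), and a balanced tree of such reductions leaves
two numbers after `O(log M)` rounds.

Concretely, with all numbers kept at a FIXED width `W` (carries out of position `W - 1` are
dropped, so all values are read modulo `2^W`; downstream `W` is chosen large enough that no
wrap-around occurs):

* `CarrySave.csaPair a b c` — one carry-save step on three `W`-bit vectors, result the pair
  `(d, e)` as a `2W`-vector; `csVal_csaPair`: `d + e ≡ a + b + c (mod 2^W)`;
* `CarrySave.compress p q` — two steps: a "4-to-2 compressor" on pairs, additive modulo `2^W`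
  (`csVal_compress`), realized at depth `14` (`ncVec_compress`);
* `CarrySave.leafVec W c b` — the pair `(c·[b], 0)` for a constant `c < 2^W` and a bit `b`;
* `ncVec_csTree` / `csVal_csTree` — the balanced tree (`treeFold`, `NCVec.treeGadget`) of
  compressors over the `M ≥ 1` leaves `cⱼ·[yⱼ]`: depth `1 + 14⌈log₂ M⌉`, size `O(M W)`, and its
  output pair `(s, e)` satisfies `s + e ≡ ∑ⱼ cⱼ [yⱼ] (mod 2^W)`.

The final addition of the two numbers and the comparison with a threshold (Vollmer 1999,
Thm. 1.24, `MAJ ∈ DEPTH(log n)`) are in `NCThreshold.lean`.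

## References

* H. Vollmer, *Introduction to Circuit Complexity* (Springer, 1999), §1.3.1, Thm. 1.20
  (iterated addition by carry-save reduction, book p. 14–15), Thm. 1.24 [Vollmer1999].
-/

namespace Literature.Computability.Complexity

open Finset

namespace CarrySave

variable {W : ℕ}

/-! ### One bit position: the full adder -/

/-- The sum bit `a ⊕ b ⊕ c` of three bits (Vollmer 1999, Thm. 1.20: `dᵢ = aᵢ ⊕ bᵢ ⊕ cᵢ`). [cite: Vollmer1999, Theorem 1.20] -/
def sum3 (a b c : Bool) : Bool := (a ^^ b) ^^ c

/-- The carry bit `maj(a, b, c)` of three bits (Vollmer 1999, Thm. 1.20: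
`e_{i+1} = (aᵢ ∧ bᵢ) ∨ (aᵢ ∧ cᵢ) ∨ (bᵢ ∧ cᵢ)`). [cite: Vollmer1999, Theorem 1.20] -/
def maj3 (a b c : Bool) : Bool := (a && b) || (c && (a ^^ b))

/-- The full-adder identity `a + b + c = (a ⊕ b ⊕ c) + 2·maj(a,b,c)`. [cite: Vollmer1999, Theorem 1.20] -/
theorem toNat_add₃ (a b c : Bool) :
    a.toNat + b.toNat + c.toNat = (sum3 a b c).toNat + 2 * (maj3 a b c).toNat := by
  cases a <;> cases b <;> cases c <;> rfl

/-! ### Bit vectors of width `W` (little endian, values `Nat.ofBits`) -/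

/-- Bitwise sum of three `W`-bit vectors. [cite: Vollmer1999, Theorem 1.20] -/
def sumVec (a b c : Fin W → Bool) : Fin W → Bool := fun i => sum3 (a i) (b i) (c i)

/-- Bitwise majority (the carries, before shifting) of three `W`-bit vectors. [cite: Vollmer1999, Theorem 1.20] -/
def majVec (a b c : Fin W → Bool) : Fin W → Bool := fun i => maj3 (a i) (b i) (c i)

/-- **Carry-save identity**: `a + b + c = d + 2m` for the bitwise sum `d` and the bitwise
majority `m` (Vollmer 1999, proof of Thm. 1.20: "Thus we conclude that `a + b + c = d + e`"). [cite: Vollmer1999, Theorem 1.20] -/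
theorem ofBits_csa : ∀ {W : ℕ} (a b c : Fin W → Bool),
    Nat.ofBits a + Nat.ofBits b + Nat.ofBits c =
      Nat.ofBits (sumVec a b c) + 2 * Nat.ofBits (majVec a b c)
  | 0, a, b, c => by simp
  | W + 1, a, b, c => by
    rw [Nat.ofBits_succ a, Nat.ofBits_succ b, Nat.ofBits_succ c, Nat.ofBits_succ (sumVec a b c),
      Nat.ofBits_succ (majVec a b c)]
    have h := ofBits_csa (a ∘ Fin.succ) (b ∘ Fin.succ) (c ∘ Fin.succ)
    have h0 := toNat_add₃ (a 0) (b 0) (c 0)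
    change _ = 2 * Nat.ofBits (sumVec (a ∘ Fin.succ) (b ∘ Fin.succ) (c ∘ Fin.succ)) +
      (sum3 (a 0) (b 0) (c 0)).toNat + 2 * (2 * Nat.ofBits (majVec (a ∘ Fin.succ) (b ∘ Fin.succ)
        (c ∘ Fin.succ)) + (maj3 (a 0) (b 0) (c 0)).toNat)
    omega

/-- The all-zero vector has value `0`. [folklore] -/
theorem ofBits_zeroVec : ∀ (W : ℕ), Nat.ofBits (fun _ : Fin W => false) = 0
  | 0 => rfl
  | W + 1 => by
    rw [Nat.ofBits_succ]
    change 2 * Nat.ofBits (fun _ : Fin W => false) + 0 = 0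
    rw [ofBits_zeroVec W]

/-- Shifting a `W`-bit vector up by one position (multiplication by two, the top bit dropped):
the placement `e₀ = 0`, `e_{i+1} = mᵢ` of the carries (Vollmer 1999, Thm. 1.20). [cite: Vollmer1999, Theorem 1.20] -/
def shiftVec (m : Fin W → Bool) : Fin W → Bool := fun i =>
  if h : 0 < (i : ℕ) then m ⟨(i : ℕ) - 1, by omega⟩ else false

/-- The shifted vector is `2m` modulo `2^W`. [folklore] -/
theorem ofBits_shiftVec_mod (m : Fin W → Bool) :
    Nat.ofBits (shiftVec m) % 2 ^ W = (2 * Nat.ofBits m) % 2 ^ W := by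
  apply Nat.eq_of_testBit_eq
  intro j
  rw [Nat.testBit_mod_two_pow, Nat.testBit_mod_two_pow,
    show (2 : ℕ) * Nat.ofBits m = 2 ^ 1 * Nat.ofBits m by rw [pow_one], Nat.testBit_two_pow_mul]
  by_cases hj : j < W
  · rw [Nat.testBit_ofBits_lt _ _ hj]
    rcases j with _ | j
    · simp [shiftVec]
    · have hj' : j < W := by omega
      simp [shiftVec, Nat.testBit_ofBits_lt _ _ hj']
  · simp [hj]

/-! ### Carry-save pairs -/

/-- The lower half (first number) of a `2W`-vector. [folklore] -/
def loHalf (v : Fin (W + W) → Bool) : Fin W → Bool := fun i => v (Fin.castAdd W i)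

/-- The upper half (second number) of a `2W`-vector. [folklore] -/
def hiHalf (v : Fin (W + W) → Bool) : Fin W → Bool := fun i => v (Fin.natAdd W i)

/-- The value, modulo `2^W`, of a carry-save pair: the sum of its two numbers. [cite: Vollmer1999, Theorem 1.20] -/
def csVal (v : Fin (W + W) → Bool) : ZMod (2 ^ W) :=
  ((Nat.ofBits (loHalf v) + Nat.ofBits (hiHalf v) : ℕ) : ZMod (2 ^ W))

/-- **One carry-save step** on three `W`-bit numbers: the pair (bitwise sum, shifted carries)
(Vollmer 1999, Thm. 1.20). [cite: Vollmer1999, Theorem 1.20] -/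
def csaPair (a b c : Fin W → Bool) : Fin (W + W) → Bool :=
  Fin.append (sumVec a b c) (shiftVec (majVec a b c))

/-- The halves of a carry-save step. [folklore] -/
@[simp] theorem loHalf_csaPair (a b c : Fin W → Bool) : loHalf (csaPair a b c) = sumVec a b c :=
  funext fun i => Fin.append_left _ _ i

/-- The halves of a carry-save step. [folklore] -/
@[simp] theorem hiHalf_csaPair (a b c : Fin W → Bool) :
    hiHalf (csaPair a b c) = shiftVec (majVec a b c) :=
  funext fun i => Fin.append_right _ _ i

/-- **Conservation modulo `2^W`**: the pair produced by a carry-save step on `a, b, c` has value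
`a + b + c (mod 2^W)` (Vollmer 1999, Thm. 1.20; the top carry is dropped at fixed width). [cite: Vollmer1999, Theorem 1.20] -/
theorem csVal_csaPair (a b c : Fin W → Bool) :
    csVal (csaPair a b c) = ((Nat.ofBits a + Nat.ofBits b + Nat.ofBits c : ℕ) : ZMod (2 ^ W)) := by
  unfold csVal
  rw [loHalf_csaPair, hiHalf_csaPair, ofBits_csa a b c, Nat.cast_add, Nat.cast_add,
    (ZMod.natCast_eq_natCast_iff' _ _ _).2 (ofBits_shiftVec_mod (majVec a b c)), Nat.cast_mul]

/-- **The 4-to-2 compressor**: two carry-save steps turn two pairs into one pair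
(Vollmer 1999, Thm. 1.20, two rounds of the reduction). [cite: Vollmer1999, Theorem 1.20] -/
def compress (p q : Fin (W + W) → Bool) : Fin (W + W) → Bool :=
  csaPair (loHalf (csaPair (loHalf p) (hiHalf p) (loHalf q)))
    (hiHalf (csaPair (loHalf p) (hiHalf p) (loHalf q))) (hiHalf q)

/-- The compressor is additive modulo `2^W`. [cite: Vollmer1999, Theorem 1.20] -/
theorem csVal_compress (p q : Fin (W + W) → Bool) : csVal (compress p q) = csVal p + csVal q := by
  have h := csVal_csaPair (loHalf p) (hiHalf p) (loHalf q)
  unfold compress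
  rw [csVal_csaPair]
  unfold csVal at h ⊢
  push_cast at h ⊢
  rw [h]
  ring

/-- The zero pair has value `0`. [folklore] -/
theorem csVal_zero (W : ℕ) : csVal (fun _ : Fin (W + W) => false) = 0 := by
  unfold csVal loHalf hiHalf
  rw [ofBits_zeroVec W]
  simp

/-- **The compressor tree computes the sum modulo `2^W`** of the values of its leaves
(Vollmer 1999, Thm. 1.20: iterating the reduction `O(log n)` times). [cite: Vollmer1999, Theorem 1.20] -/
theorem csVal_treeFold (M : ℕ) (leaf : Fin M → Fin (W + W) → Bool) :
    csVal (treeFold compress (fun _ => false) M leaf) = ∑ j, csVal (leaf j) := by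
  rw [treeFold_map compress (fun _ => false) (· + ·) (0 : ZMod (2 ^ W)) csVal csVal_compress
    (csVal_zero W) M leaf, treeFold_add]

/-! ### Leaves: a constant times a bit -/

/-- The pair `(c·[b], 0)` of width `W` for a constant `c` and a bit `b`: bit `i` of the first
number is `cᵢ ∧ b` (hard-wired constant; Vollmer 1999, Thm. 1.23-style masking). [cite: Vollmer1999, Theorem 1.20] -/
def leafVec (W : ℕ) (c : ℕ) (b : Bool) : Fin (W + W) → Bool :=
  Fin.append (fun i : Fin W => c.testBit i && b) (fun _ : Fin W => false)

/-- The value of a leaf is `c·[b]` when `c < 2^W`. [folklore] -/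
theorem csVal_leafVec (W c : ℕ) (b : Bool) (hc : c < 2 ^ W) :
    csVal (leafVec W c b) = ((c * b.toNat : ℕ) : ZMod (2 ^ W)) := by
  unfold csVal leafVec loHalf hiHalf
  simp only [Fin.append_left, Fin.append_right]
  rw [ofBits_zeroVec W]
  cases b
  · simp only [Bool.and_false, Bool.toNat_false, mul_zero]
    rw [ofBits_zeroVec W]
    simp
  · simp only [Bool.and_true, Bool.toNat_true, mul_one, add_zero]
    rw [Nat.ofBits_testBit, Nat.mod_eq_of_lt hc]

/-- **The carry-save tree of the terms `cⱼ·[yⱼ]`** has value `∑ⱼ cⱼ [yⱼ]` modulo `2^W`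
(all `cⱼ < 2^W`). [cite: Vollmer1999, Theorem 1.20] -/
theorem csVal_csTree (M : ℕ) (c : Fin M → ℕ) (hc : ∀ j, c j < 2 ^ W) (y : Fin M → Bool) :
    csVal (treeFold compress (fun _ => false) M fun j => leafVec W (c j) (y j)) =
      ((∑ j, c j * (y j).toNat : ℕ) : ZMod (2 ^ W)) := by
  rw [csVal_treeFold]
  push_cast
  exact Finset.sum_congr rfl fun j _ => by rw [csVal_leafVec _ _ _ (hc j)]; push_cast; rfl

/-! ### Realization over `B₂` -/

/-- **One carry-save step in constant depth**: reading three `W`-bit numbers off arbitrary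
wires, the pair `csaPair` is realized at depth `7` with `72 W` gates (each output bit is a
function of three input bits; Vollmer 1999, Thm. 1.20: "d and e can be computed in constant
depth by just hardwiring their defining formulas"). [cite: Vollmer1999, Theorem 1.20] -/
theorem ncVec_csaPair {κ : Type*} (sa sb sc : Fin W → κ) :
    NCVec (fun (y : κ → Bool) => csaPair (fun i => y (sa i)) (fun i => y (sb i)) fun i => y (sc i))
      7 ((W + W) * 36) := by
  refine NCVec.pi_fin fun p => ?_
  induction p using Fin.addCases with
  | left i =>
    have h := (ncVec_proj (ι := κ) ![sa i, sb i, sc i]).comp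
      (ncVec_univ (ι' := Fin 3) fun v _ => sum3 (v 0) (v 1) (v 2))
    refine (h.congr fun y _ => ?_).mono (by simp) (by simp [univBound])
    simp [csaPair, sumVec]
  | right i =>
    by_cases hi : 0 < (i : ℕ)
    · have h := (ncVec_proj (ι := κ)
        ![sa ⟨(i : ℕ) - 1, by omega⟩, sb ⟨(i : ℕ) - 1, by omega⟩, sc ⟨(i : ℕ) - 1, by omega⟩]).comp
        (ncVec_univ (ι' := Fin 3) fun v _ => maj3 (v 0) (v 1) (v 2))
      refine (h.congr fun y _ => ?_).mono (by simp) (by simp [univBound])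
      simp only [csaPair, Fin.append_right]
      simp [shiftVec, majVec, hi]
    · have h := ncVec_gate (ι := κ) ⟨0, fun _ => false⟩ (by simp [B2]) Fin.elim0
      refine (h.congr fun y _ => ?_).mono (by simp) (by simp)
      simp only [csaPair, Fin.append_right]
      simp [shiftVec, hi]

/-- **The compressor gadget**: two pairs in, one pair out, depth `14`, `144 W` gates. [cite: Vollmer1999, Theorem 1.20] -/
theorem ncVec_compress (W : ℕ) :
    NCVec (fun (y : Fin (W + W) ⊕ Fin (W + W) → Bool) =>
      compress (fun i => y (.inl i)) fun i => y (.inr i)) 14 ((W + W) * 36 + (W + W) * 36) := by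
  have h1 := (ncVec_csaPair (κ := Fin (W + W) ⊕ Fin (W + W)) (fun i => .inl (Fin.castAdd W i))
    (fun i => .inl (Fin.natAdd W i)) (fun i => .inr (Fin.castAdd W i))).pair
    (ncVec_proj fun i : Fin W => (Sum.inr (Fin.natAdd W i) : Fin (W + W) ⊕ Fin (W + W)))
  have h2 := h1.comp (ncVec_csaPair (κ := Fin (W + W) ⊕ Fin W) (fun i => .inl (Fin.castAdd W i))
    (fun i => .inl (Fin.natAdd W i)) (fun i => .inr i))
  refine (h2.congr fun y p => ?_).mono (by simp) (by simp)
  simp only [Sum.elim_inl, Sum.elim_inr]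
  rfl

/-- **The leaves in depth one**: the pairs `(cⱼ·[yⱼ], 0)`, `j < M`, each bit a projection of
`yⱼ` or the constant `0`. [cite: Vollmer1999, Theorem 1.20] -/
theorem ncVec_leaves (W M : ℕ) (c : Fin M → ℕ) :
    NCVec (fun (y : Fin M → Bool) (jp : Fin M × Fin (W + W)) => leafVec W (c jp.1) (y jp.1) jp.2)
      1 (M * ((W + W) * 1)) := by
  refine NCVec.pi_finVec (F := fun y j p => leafVec W (c j) (y j) p) fun j =>
    NCVec.pi_fin (f := fun y p => leafVec W (c j) (y j) p) fun p => ?_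
  induction p using Fin.addCases with
  | left i =>
    by_cases hb : (c j).testBit i = true
    · exact ((ncVec_proj fun _ : Unit => j).congr fun y _ => by simp [leafVec, hb]).mono
        (Nat.zero_le _) (Nat.zero_le _)
    · exact (ncVec_gate ⟨0, fun _ => false⟩ (by simp [B2]) Fin.elim0).congr fun y _ => by
        simp [leafVec, hb]
  | right i =>
    exact (ncVec_gate ⟨0, fun _ => false⟩ (by simp [B2]) Fin.elim0).congr fun y _ => by
      simp only [leafVec, Fin.append_right]

/-- **The carry-save tree** over the `M ≥ 1` terms `cⱼ·[yⱼ]`: depth `1 + 14⌈log₂ M⌉`, size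
`2MW + 144(M-1)W` (Vollmer 1999, Thm. 1.20: "the `O(log n)` iterations of reducing the number
of terms take depth `O(log n)`"). [cite: Vollmer1999, Theorem 1.20] -/
theorem ncVec_csTree (W M : ℕ) (hM : 1 ≤ M) (c : Fin M → ℕ) :
    NCVec (fun (y : Fin M → Bool) => treeFold compress (fun _ => false) M fun j =>
        leafVec W (c j) (y j))
      (1 + Nat.clog 2 M * 14) (M * ((W + W) * 1) + (M - 1) * ((W + W) * 36 + (W + W) * 36)) :=
  (ncVec_leaves W M c).comp (NCVec.treeGadget (ncVec_compress W) (fun _ => false) M hM)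

end CarrySave

end Literature.Computability.Complexity
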